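import Summits.ValiantsHypothesis.ValiantsHypothesis.Theorems.DivisionGapZeroOneTransferIMMToSpanAux

/-!
# Padding lemma for line `arborescence-span` (crux `ZeroOneTransfer`, stmt-ValiantsHypothesis-5066) —
# the arborescences of the padded digraph `H_{s,t}` and its spanning-tree polynomial

Support file for `stub_immToSpan` (objects in `Theorems/DivisionGapZeroOneTransferIMMToSpanDefs.lean`,
main file `Theorems/DivisionGapZeroOneTransferIMMToSpan.lean`).  For labelled matrices
`M : Fin d → Matrix ι ι R` and `s t : ι`, the arborescences of nonzero weight of `H_{s,t}` are
parametrised (`ext`) by the pairs (`params d s t`) of an index path `π : s ⇝ t` and a choice function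
agreeing with it: `ext_mem_arbsV` (choices of nonzero weight give arborescences, by the rank `rkV`),
`ext_inj` (the path is read off the choices), `exists_param` (an arborescence of nonzero weight
follows matrix arcs from `(0, s)` all the way to `(d, t)`, since a feedback arc below `(0, s)` would
close a cycle).  Hence `stV_labH` (registered sub-goal `stub_immToSpan_stH`): the spanning-tree
polynomial of `H_{s,t}` is `(Σ_{π : s ⇝ t} Π_l M_l (π l) (π (l+1))) · W^{(d+1)(#ι-1)}` — regroup with
`Finset.prod_univ_sum`, every free program node contributing its full out-label
`W = 1 + Σ_{l,i,j} M l i j`. [folklore]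
-/

noncomputable section

namespace Summit.ValiantsHypothesis.ValiantsHypothesis.Theorems.DivisionGapZeroOneTransfer

-- the single-problem summit's namespace `Summit.ValiantsHypothesis.ValiantsHypothesis` repeats
set_option linter.dupNamespace false

namespace IMMToSpan

open Literature.Computability.AlgebraicComplexity Literature.Barriers.ValiantsHypothesis
open MvPolynomial Finset

section Graph

variable {ι : Type} {d : ℕ} [DecidableEq ι] {R : Type} [CommSemiring R] (M : Fin d → Matrix ι ι R)
  [Fintype ι]

/-- **Parameters of nonzero weight give arborescences** (the rank `rkP`). [folklore] -/
theorem ext_mem_arbsV {s t : ι} {π : Fin (d + 1) → ι} {c : PN ι d → Option (VN ι d)}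
    (hπ : π ∈ paths d s t) (hc : c ∈ Fintype.piFinset (tgt π))
    (hw : wt (labH M s t) (ext s c) ≠ 0) : ext s c ∈ arbsV (VN ι d) := by
  rw [mem_arbsV]
  obtain ⟨hπ0, -⟩ := mem_paths.mp hπ
  have hl := label_ne_zero_of_wt_ne_zero hw
  refine ⟨rkV π s, ?_⟩
  rintro (u | r) w hvw
  · change c u = some w at hvw
    have hcu := Fintype.mem_piFinset.mp hc u
    have hlu : labH M s t (.prog u) (c u) ≠ 0 := hl (.prog u)
    rcases labH_prog_ne_zero M hlu with ⟨o', ho'⟩ | ⟨hnone, -⟩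
    · rw [ho', Option.some.injEq] at hvw
      subst hvw
      rw [rkV, rkV]
      by_cases hon : u.2 = π u.1
      · -- on the path: the forced own-row arc, one layer up
        rw [tgt, if_pos hon, Finset.mem_singleton, next] at hcu
        obtain ⟨ℓ, i⟩ := u
        dsimp only at hon hcu ⊢
        subst hon
        induction ℓ using Fin.lastCases with
        | last => rw [Fin.lastCases_last] at hcu; rw [hcu] at ho'; cases ho'
        | cast ℓ =>
          rw [Fin.lastCases_castSucc, ownArc] at hcu
          rw [hcu, Option.some.injEq, VN.relay.injEq, Prod.mk.injEq] at ho'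
          rw [← ho'.2, relayTgt_own, rkP, rkP, if_pos rfl, if_pos rfl]
          simp only [Fin.val_castSucc, Fin.val_succ]
          have := ℓ.2
          omega
      · -- off the path
        have hru : rkP π u = 4 * d + 3 - 2 * u.1 := if_neg hon
        have hu1 := u.1.2
        rcases relayTgt_cases s (u, o') with hfb | ⟨e, -, he1, -, htg⟩
        · have hr0 : rkP π (relayTgt s (u, o')) = 2 * d := by
            rw [hfb, rkP, if_pos hπ0.symm, Fin.val_zero, Nat.sub_zero]
          rw [hr0, hru]
          omega
        · have hb := rkP_le π (relayTgt s (u, o'))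
          rw [htg] at hb ⊢
          simp only [Fin.val_succ] at hb
          dsimp only at he1
          have he := e.1.2
          rw [hru]
          omega
    · rw [hnone] at hvw
      cases hvw
  · change some (VN.prog (relayTgt s r)) = some w at hvw
    rw [Option.some.injEq] at hvw
    subst hvw
    rw [rkV, rkV]
    exact Nat.lt_succ_self _

/-- **Injectivity of the parametrisation**: the path is read off the choice function. [folklore] -/
theorem ext_inj {s t : ι} {p q : (Fin (d + 1) → ι) × (PN ι d → Option (VN ι d))}
    (hp : p ∈ params d s t) (hq : q ∈ params d s t) (h : ext s p.2 = ext s q.2) : p = q := by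
  obtain ⟨π₁, c₁⟩ := p
  obtain ⟨π₂, c₂⟩ := q
  rw [mem_params, mem_paths, Fintype.mem_piFinset] at hp hq
  have hc : c₁ = c₂ := funext fun u => congrFun h (.prog u)
  subst hc
  refine Prod.ext ?_ rfl
  funext ℓ
  induction ℓ using Fin.induction with
  | zero => rw [hp.1.1, hq.1.1]
  | succ ℓ ih =>
    have h1 := hp.2 (ℓ.castSucc, π₁ ℓ.castSucc)
    have h2 := hq.2 (ℓ.castSucc, π₁ ℓ.castSucc)
    rw [tgt, if_pos rfl, Finset.mem_singleton] at h1
    rw [tgt, if_pos ih, Finset.mem_singleton] at h2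
    rw [h1, next, next, Fin.lastCases_castSucc, Fin.lastCases_castSucc, ownArc, ownArc] at h2
    simp only [Option.some.injEq, VN.relay.injEq, Prod.mk.injEq] at h2
    exact h2.2.2.2

/-- **Surjectivity of the parametrisation**: an arborescence of nonzero weight follows matrix
arcs from `(0, s)` all the way to `(d, t)` (a feedback arc would close a cycle), so it is `ext` of
its restriction to the program nodes, which agrees with the path `pathOf s T`. [folklore] -/
theorem exists_param {s t : ι} {T : VN ι d → Option (VN ι d)} (hT : T ∈ arbsV (VN ι d))
    (hw : wt (labH M s t) T ≠ 0) : ∃ p ∈ params d s t, ext s p.2 = T := by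
  obtain ⟨rk, hrk⟩ := mem_arbsV.mp hT
  have hl := label_ne_zero_of_wt_ne_zero hw
  set π := pathOf s T with hπ
  have hπ0 : π 0 = s := Fin.induction_zero _ _
  have hπs : ∀ ℓ : Fin d,
      π ℓ.succ = stepι (π ℓ.castSucc) (T (.prog (ℓ.castSucc, π ℓ.castSucc))) :=
    fun ℓ => Fin.induction_succ _ _ ℓ
  have hrel : ∀ r, T (.relay r) = some (.prog (relayTgt s r)) :=
    fun r => labH_relay_ne_zero M (hl (.relay r))
  have hprog : ∀ u : PN ι d, (∃ o', T (.prog u) = some (.relay (u, o'))) ∨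
      (T (.prog u) = none ∧ u = (Fin.last d, t)) := fun u => labH_prog_ne_zero M (hl (.prog u))
  -- no feedback arc out of a node ranked below `(0, s)`
  have hnofb : ∀ (u : PN ι d) (o' : Option (EN ι d)), T (.prog u) = some (.relay (u, o')) →
      rk (.prog u) ≤ rk (.prog (0, s)) → relayTgt s (u, o') ≠ (0, s) := by
    intro u o' hu hle heq
    have h1 := hrk _ _ hu
    have h2 := hrk _ _ (hrel (u, o'))
    rw [heq] at h2
    omega
  -- (A) path nodes are ranked below `(0, s)`
  have hA : ∀ ℓ : Fin (d + 1), (∀ ℓ' : Fin d, ℓ'.castSucc < ℓ →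
      T (.prog (ℓ'.castSucc, π ℓ'.castSucc)) = ownArc π ℓ') →
      rk (.prog (ℓ, π ℓ)) ≤ rk (.prog (0, s)) := by
    intro ℓ
    induction ℓ using Fin.induction with
    | zero => intro; rw [hπ0]
    | succ ℓ ih =>
      intro hgood
      have hG := hgood ℓ Fin.castSucc_lt_succ
      have ih' := ih fun ℓ' hℓ' => hgood ℓ' (lt_trans hℓ' Fin.castSucc_lt_succ)
      have h1 := hrk _ _ hG
      have h2 := hrk _ _ (hrel ((ℓ.castSucc, π ℓ.castSucc), some (ℓ, π ℓ.castSucc, π ℓ.succ)))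
      rw [relayTgt_own] at h2
      exact le_trans (le_of_lt (lt_trans h2 h1)) ih'
  -- (B) every path node below layer `d` takes its own-row matrix arc
  have hB : ∀ ℓ : Fin d, T (.prog (ℓ.castSucc, π ℓ.castSucc)) = ownArc π ℓ := by
    suffices H : ∀ n, ∀ ℓ : Fin d, (ℓ : ℕ) < n →
        T (.prog (ℓ.castSucc, π ℓ.castSucc)) = ownArc π ℓ from
      fun ℓ => H _ ℓ (Nat.lt_succ_self _)
    intro n
    induction n with
    | zero => intro ℓ h; omega
    | succ n ih =>
      intro ℓ hℓ
      rcases Nat.lt_succ_iff_lt_or_eq.mp hℓ with h | h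
      · exact ih ℓ h
      have hle := hA ℓ.castSucc fun ℓ' hℓ' => ih ℓ' (by
        rw [Fin.castSucc_lt_castSucc_iff, Fin.lt_def] at hℓ'; omega)
      rcases hprog (ℓ.castSucc, π ℓ.castSucc) with ⟨o', ho'⟩ | ⟨-, hu⟩
      · rcases relayTgt_cases s ((ℓ.castSucc, π ℓ.castSucc), o') with hfb | ⟨e, he, he1, he2, -⟩
        · exact absurd hfb (hnofb _ _ ho' hle)
        · dsimp only at he he1 he2
          have he1' : e.1 = ℓ := Fin.ext (by simpa using he1)
          have hsucc : π ℓ.succ = e.2.2 := by rw [hπs, ho', he]; rfl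
          rw [ho', he, ownArc, hsucc, ← he2, ← he1']
      · exact absurd (congrArg Prod.fst hu) (Fin.castSucc_lt_last ℓ).ne
  -- (C) the last path node is `(d, t)` and takes the root arc
  have hle := hA (Fin.last d) fun ℓ' _ => hB ℓ'
  have hC : T (.prog (Fin.last d, π (Fin.last d))) = none ∧ π (Fin.last d) = t := by
    rcases hprog (Fin.last d, π (Fin.last d)) with ⟨o', ho'⟩ | ⟨hn, hu⟩
    · exfalso
      rcases relayTgt_cases s ((Fin.last d, π (Fin.last d)), o') with hfb | ⟨e, -, he1, -, -⟩
      · exact hnofb _ _ ho' hle hfb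
      · simp only [Fin.val_last] at he1
        have := e.1.2
        omega
    · exact ⟨hn, congrArg Prod.snd hu⟩
  refine ⟨(π, fun u => T (.prog u)), ?_, ?_⟩
  · refine mem_params.mpr ⟨mem_paths.mpr ⟨hπ0, hC.2⟩, Fintype.mem_piFinset.mpr fun u => ?_⟩
    dsimp only
    rw [tgt]
    split_ifs with hon
    · rw [Finset.mem_singleton, next]
      obtain ⟨ℓ, i⟩ := u
      dsimp only at hon ⊢
      subst hon
      induction ℓ using Fin.lastCases with
      | last => rw [Fin.lastCases_last]; exact hC.1
      | cast ℓ => rw [Fin.lastCases_castSucc]; exact hB ℓ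
    · exact Finset.mem_univ _
  · funext v
    rcases v with u | r
    · rfl
    · exact (hrel r).symm

/-- **The spanning-tree polynomial of `H_{s,t}`** is the `(s,t)` path sum times the padding
factor `W^{(d+1)(#ι-1)}`. [folklore] -/
theorem stV_labH (s t : ι) : stV (labH M s t) =
    (∑ π ∈ paths d s t, pathProd M π) * (W M ^ (Fintype.card ι - 1)) ^ (d + 1) := by
  rw [stV_eq_sum_of_param (labH M s t) (params d s t) (fun p => ext s p.2)
    (fun p hp hw => ext_mem_arbsV M (mem_params.mp hp).1 (mem_params.mp hp).2 hw)
    (fun p hp q hq h => ext_inj hp hq h) (fun T hT hw => exists_param M hT hw),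
    Finset.sum_finset_product (params d s t) (paths d s t) (fun π => Fintype.piFinset (tgt π))
    (fun p => mem_params), Finset.sum_mul]
  refine Finset.sum_congr rfl fun π hπ => ?_
  obtain ⟨-, hπt⟩ := mem_paths.mp hπ
  simp only [wt_ext]
  rw [← Finset.prod_univ_sum]
  have hu : ∀ u : PN ι d, ∑ o ∈ tgt π u, labH M s t (.prog u) o =
      if u.2 = π u.1 then labH M s t (.prog u) (next π u) else W M := by
    intro u
    unfold tgt
    split_ifs with h
    · exact Finset.sum_singleton _ _
    · refine sum_labH_prog M s t u fun hu => h ?_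
      rw [hu, hπt]
  simp_rw [hu]
  rw [Fintype.prod_prod_type]
  simp_rw [prod_ite_eq_mul_pow]
  rw [Finset.prod_mul_distrib, Finset.prod_const, Finset.card_univ, Fintype.card_fin,
    Fin.prod_univ_castSucc]
  have hlast : labH M s t (.prog (Fin.last d, π (Fin.last d)))
      (next π (Fin.last d, π (Fin.last d))) = 1 := by
    rw [next, Fin.lastCases_last, hπt]
    simp [labH]
  rw [hlast, mul_one]
  congr 1
  refine Fintype.prod_congr _ _ fun ℓ => ?_
  rw [next, Fin.lastCases_castSucc, ownArc]
  simp [labH, lab₀]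

end Graph

end IMMToSpan

/-! ### Registered sub-goal -/

/-- **The spanning-tree polynomial of `H_{s,t}`** is the `(s,t)` path sum times the padding factor
`W^{(d+1)(#ι-1)}` (registered sub-goal `stub_immToSpan_stH` of `stub_immToSpan`). [folklore] -/
theorem stub_immToSpan_stH :
    ∀ (ι : Type) (d : ℕ) [DecidableEq ι] (R : Type) [CommSemiring R] (M : Fin d → Matrix ι ι R)
      [Fintype ι] (s t : ι),
      Summit.ValiantsHypothesis.ValiantsHypothesis.Theorems.DivisionGapZeroOneTransfer.IMMToSpan.stV
          (Summit.ValiantsHypothesis.ValiantsHypothesis.Theorems.DivisionGapZeroOneTransfer.IMMToSpan.labH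
            M s t) =
        (∑ π ∈ Summit.ValiantsHypothesis.ValiantsHypothesis.Theorems.DivisionGapZeroOneTransfer.IMMToSpan.paths
            d s t,
          Summit.ValiantsHypothesis.ValiantsHypothesis.Theorems.DivisionGapZeroOneTransfer.IMMToSpan.pathProd
            M π) *
          (Summit.ValiantsHypothesis.ValiantsHypothesis.Theorems.DivisionGapZeroOneTransfer.IMMToSpan.W M ^
              (Fintype.card ι - 1)) ^ (d + 1) :=
  fun _ _ _ _ _ M _ s t => IMMToSpan.stV_labH M s t

end Summit.ValiantsHypothesis.ValiantsHypothesis.Theorems.DivisionGapZeroOneTransfer
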